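import Summits.HubbardSuperconductivity.HubbardSuperconductivity.Theses.FunctionFieldCertificate
import Summits.HubbardSuperconductivity.HubbardSuperconductivity.Theorems.FunctionFieldCertificateMesoscopicPairOrderInfraredWeight
import Summits.HubbardSuperconductivity.HubbardSuperconductivity.Theorems.FunctionFieldCertificateMesoscopicPairOrderNecessity
import HarnessLib

/-!
# `MesoscopicPairOrder` (stmt-HubbardSuperconductivity-7331) — the pointwise split (sorry-free glue):
# Goldstone pair profile + ONE leak-beating block scale ⇒ the crux

Route `FunctionFieldCertificate`, crux 2 (pole-free half): at one `(U, δ)` a margin `m R² ≤ T_R(ψ)/L²`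
for the Fejér-box pair functional `T_R(ψ) = Σ_{x,y} Πᵢ (1 - |(y - x)ᵢ|_L/R)₊ Re⟨P_x ψ, P_y ψ⟩`,
`P_x = localPair dWaveFormFactor L x`, at ARBITRARILY LARGE scales `R`, in every normalised
`(N_L, S^z = 0)`-sector ground state of `hubbardTorus 2 L 1 U` on all large even tori. The crux is open
physics and is NOT settled here. This support file is the sorry-free part of line `pointwise_split`
(`Cruxes/MesoscopicPairOrder/Lines/pointwise_split.lean`; strategist cstrat-p1, landed by lead c6) — the
glue of the typed two-piece decomposition, in the momentum vocabulary of the route's pole half: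

* (A) **Goldstone pair profile** — at every `(U, δ)`, every normalised sector ground state of every large
  even torus has `S_ψ(m) ≤ S + A/|q_m|` for all `m ≠ 0` (flat normal background + Goldstone `1/|q|`).
  Implies the Σ-form pole half `WindowInfraredBound` (`windowInfraredBound_of_goldstonePairProfile`).
* (B) **Leak-beating block pair seed** — at SOME `(U, δ)`: for every budget `(S, A)` there are ONE block
  scale `R₀ > 0`, a radius `ε > 0` and a margin `m₀ > 32 ε (S ε + A) + (S + A/ε)/R₀²` such that the crux
  body holds AT THE SINGLE SCALE `R₀` in every normalised sector ground state of every large even torus.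
  A consequence of the crux (`leakBeatingBlockPairSeed_of_mesoscopicPairOrder`).
* `pairStructureFactor_zero_ge_of_seed_of_profile` — **pointwise one-scale closure** (model-free): seed at
  scale `R` + profile ⇒ `(m₀ - 32ε(Sε + A) - (S + A/ε)/R²) L² ≤ S_ψ(0)` (momentum identity
  `R² T_R = Σ_m |F_R(m)|² S_ψ(m)`, `|F_R|² ≤ R⁴` on the zero mode and the punctured window, profile cap
  `S + A/ε` off the window against the Parseval mass — no `1/ε²` kernel tail, so `R₀ ≈ √(2S/m₀) ~ 10²`).
* `mesoscopicPairOrder_of_subs` — **(A) → (B) → `MesoscopicPairOrder`**; hypotheses = the verbatim bodies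
  of the registered stubs `stub_goldstonePairProfile` / `stub_leakBeatingBlockPairSeed` (the `--glue-by`
  theorem of the route split `MesoscopicPairOrder ⇐ GoldstonePairProfile ∧ LeakBeatingBlockPairSeed`).

Sources: Kennedy–Lieb–Shastry, PRL 61 (1988) 2582 [KLS1988PRL]; Dyson–Lieb–Simon, J. Stat. Phys. 18
(1978) 335, Thms 3.1–4.2 [DysonLiebSimon1978]; Pitaevskii–Stringari, J. Low Temp. Phys. 85 (1991) 377
[PitaevskiiStringari1991]; Stein–Shakarchi, *Fourier Analysis* (2003), Ch. 2. Folklore; no definition introduced.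
-/

noncomputable section

-- the summit namespace repeats the problem name by design (D-0017)
set_option linter.dupNamespace false

namespace Summit.HubbardSuperconductivity.HubbardSuperconductivity.Theorems.FunctionFieldCertificate

open Matrix Finset Filter
open Literature.Probability.LatticeModels Literature.MathematicalPhysics.QuantumLattice
open Summit.HubbardSuperconductivity.HubbardSuperconductivity.Theses.FunctionFieldCertificate
open scoped ComplexOrder ComplexConjugate

variable {L : ℕ} [NeZero L]

/-! ### The punctured window under a Goldstone profile -/

/-- **Punctured-window pair weight under a Goldstone profile.** If a nonnegative function `f` on the
momentum labels obeys `f(m) ≤ S + A/|q_m|` for `m ≠ 0` (`S, A ≥ 0`), then for `0 < ε`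
`Σ_{m ≠ 0, |q_m|² ≤ ε²} f(m) ≤ 32 ε (S ε + A) L²`: inside the window `S ≤ S ε/|q_m|`, and the window
lattice sum `Σ_{0 < |q_m| < 2ε} |q_m|⁻¹ ≤ 32 ε L²` (`wls_window_sum_le`, `α = 1`). [folklore] -/
theorem windowProfileSum_le (L : ℕ) [NeZero L] {ε S A : ℝ} (hε : 0 < ε) (hS : 0 ≤ S) (hA : 0 ≤ A)
    (f : TorusSite 2 L → ℝ)
    (hprof : ∀ m : TorusSite 2 L, m ≠ 0 → f m ≤ S + A / Real.sqrt (momentumNormSq L m)) :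
    (∑ m ∈ Finset.univ.filter (fun m : TorusSite 2 L => m ≠ 0 ∧ momentumNormSq L m ≤ ε ^ 2), f m) ≤
      32 * ε * (S * ε + A) * (L : ℝ) ^ 2 := by
  classical
  set W := Finset.univ.filter (fun m : TorusSite 2 L => m ≠ 0 ∧ momentumNormSq L m ≤ ε ^ 2) with hW
  set W2 := Finset.univ.filter (fun m : TorusSite 2 L => m ≠ 0 ∧ momentumNormSq L m < (2 * ε) ^ 2)
    with hW2
  -- pointwise: on the window, `f m ≤ (S ε + A) / |q_m|`
  have hpt : ∀ m ∈ W, f m ≤ (S * ε + A) * (momentumNormSq L m ^ ((1:ℝ) / 2))⁻¹ := by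
    intro m hm
    rw [hW, Finset.mem_filter] at hm
    obtain ⟨-, hm0, hmε⟩ := hm
    have hqpos : 0 < momentumNormSq L m :=
      lt_of_le_of_ne (momentumNormSq_nonneg m) (fun h => hm0 ((momentumNormSq_eq_zero_iff m).1 h.symm))
    have hr : 0 < Real.sqrt (momentumNormSq L m) := Real.sqrt_pos.2 hqpos
    have hrε : Real.sqrt (momentumNormSq L m) ≤ ε := by
      rw [← Real.sqrt_sq hε.le]
      exact Real.sqrt_le_sqrt hmε
    rw [← Real.sqrt_eq_rpow]
    have h1 : S ≤ S * ε / Real.sqrt (momentumNormSq L m) := by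
      rw [le_div_iff₀ hr]
      exact mul_le_mul_of_nonneg_left hrε hS
    calc f m ≤ S + A / Real.sqrt (momentumNormSq L m) := hprof m hm0
      _ ≤ S * ε / Real.sqrt (momentumNormSq L m) + A / Real.sqrt (momentumNormSq L m) := by linarith
      _ = (S * ε + A) * (Real.sqrt (momentumNormSq L m))⁻¹ := by ring
  have hsub : W ⊆ W2 := by
    intro m hm
    rw [hW, Finset.mem_filter] at hm
    rw [hW2, Finset.mem_filter]
    refine ⟨hm.1, hm.2.1, lt_of_le_of_lt hm.2.2 ?_⟩
    nlinarith
  have hnn : ∀ m ∈ W2, 0 ≤ (momentumNormSq L m ^ ((1:ℝ) / 2))⁻¹ := fun m _ =>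
    inv_nonneg.2 (Real.rpow_nonneg (momentumNormSq_nonneg m) _)
  have hwls := wls_window_sum_le (α := 1) (by norm_num) (by norm_num) (η := 2 * ε) (by positivity) L
  have hwls' : (∑ m ∈ W2, (momentumNormSq L m ^ ((1:ℝ) / 2))⁻¹) ≤ 32 * ε * (L : ℝ) ^ 2 := by
    have e1 : (2 : ℝ) - 1 = 1 := by norm_num
    rw [e1, Real.rpow_one] at hwls
    calc (∑ m ∈ W2, (momentumNormSq L m ^ ((1:ℝ) / 2))⁻¹) ≤ 8 * (1 + 1 / 1) * (2 * ε) * (L : ℝ) ^ 2 :=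
          hwls
      _ = 32 * ε * (L : ℝ) ^ 2 := by ring
  have hSA : 0 ≤ S * ε + A := by positivity
  calc (∑ m ∈ W, f m) ≤ ∑ m ∈ W, (S * ε + A) * (momentumNormSq L m ^ ((1:ℝ) / 2))⁻¹ :=
        Finset.sum_le_sum hpt
    _ = (S * ε + A) * ∑ m ∈ W, (momentumNormSq L m ^ ((1:ℝ) / 2))⁻¹ := by rw [Finset.mul_sum]
    _ ≤ (S * ε + A) * ∑ m ∈ W2, (momentumNormSq L m ^ ((1:ℝ) / 2))⁻¹ :=
        mul_le_mul_of_nonneg_left (Finset.sum_le_sum_of_subset_of_nonneg hsub fun m hm _ => hnn m hm) hSA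
    _ ≤ (S * ε + A) * (32 * ε * (L : ℝ) ^ 2) := mul_le_mul_of_nonneg_left hwls' hSA
    _ = 32 * ε * (S * ε + A) * (L : ℝ) ^ 2 := by ring

/-! ### Parseval mass of the Fejér weights -/

/-- **`Σ_m |F_R(m)|² = L² R²`** for the box kernel `F_R(m) = Σ_{u ∈ [0,R)²} χ_m(u)`, `R ≤ L` (real
form of `sum_conj_boxKernel_mul_boxKernel`). Stein–Shakarchi, *Fourier Analysis*, Ch. 2. [folklore] -/
theorem sum_normSq_boxKernel_eq (R : ℕ) (hRL : R ≤ L) :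
    ∑ m : TorusSite 2 L, ‖∑ u : Fin 2 → Fin R, torusChar m (fun i => ((u i : ℕ) : ZMod L))‖ ^ 2 =
      (L : ℝ) ^ 2 * (R : ℝ) ^ 2 := by
  have h := congrArg Complex.re (sum_conj_boxKernel_mul_boxKernel (L := L) R hRL)
  rw [Complex.re_sum] at h
  have hterm : ∀ m : TorusSite 2 L,
      (conj (∑ u : Fin 2 → Fin R, torusChar m (fun i => ((u i : ℕ) : ZMod L))) *
          (∑ u : Fin 2 → Fin R, torusChar m (fun i => ((u i : ℕ) : ZMod L)))).re =
        ‖∑ u : Fin 2 → Fin R, torusChar m (fun i => ((u i : ℕ) : ZMod L))‖ ^ 2 := by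
    intro m
    rw [Complex.conj_mul', ← Complex.ofReal_pow, Complex.ofReal_re]
  simp only [hterm] at h
  rw [h]
  norm_cast

/-! ### Pointwise one-scale closure -/

/-- **POINTWISE ONE-SCALE CLOSURE** (one even side `L`, one vector; model-free). Let `0 < R`,
`2R ≤ L`, `0 < ε`, `S, A ≥ 0`. If a Fock vector `ψ` has a Goldstone pair profile off the zero mode,
`S_ψ(m) ≤ S + A/|q_m|` for all `m ≠ 0`, and Fejér-box order `m₀ R² ≤ T_R(ψ)/L²` at the ONE scale `R`,
then its zero-mode pair structure factor is macroscopic: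
`(m₀ - 32 ε (S ε + A) - (S + A/ε)/R²) · L² ≤ S_ψ(0)`.
Proof: `R² T_R = Σ_m |F_R(m)|² S_ψ(m)`; the zero mode and the punctured window `|q_m| ≤ ε` carry
kernel weight `≤ R⁴` (and the window at most `32ε(Sε + A)L²` of structure factor,
`windowProfileSum_le`); OFF the window `S_ψ ≤ S + A/ε` against the Parseval mass `Σ_m |F_R|² = L²R²`.
Kennedy–Lieb–Shastry, PRL 61 (1988) 2582; Dyson–Lieb–Simon (1978) Thm 4.2. [folklore] -/
theorem pairStructureFactor_zero_ge_of_seed_of_profile (R : ℕ) (hR : 0 < R) (hRL : 2 * R ≤ L)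
    {ε S A m₀ : ℝ} (hε : 0 < ε) (hS : 0 ≤ S) (hA : 0 ≤ A) (ψ : Fock (Orb (FermionTorus 2 L)))
    (hprof : ∀ m : TorusSite 2 L, m ≠ 0 →
      pairStructureFactor dWaveFormFactor L ψ m ≤ S + A / Real.sqrt (momentumNormSq L m))
    (hseed : m₀ * (R : ℝ) ^ 2 ≤ (∑ x : TorusSite 2 L, ∑ y : TorusSite 2 L,
        (∏ i : Fin 2, max 0 (1 - |(((y i - x i).valMinAbs : ℤ) : ℝ)| / (R : ℝ))) *
          (star (localPair dWaveFormFactor L x *ᵥ ψ) ⬝ᵥ (localPair dWaveFormFactor L y *ᵥ ψ)).re) /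
        (L : ℝ) ^ 2) :
    (m₀ - 32 * ε * (S * ε + A) - (S + A / ε) / (R : ℝ) ^ 2) * (L : ℝ) ^ 2 ≤
      pairStructureFactor dWaveFormFactor L ψ 0 := by
  classical
  have hLpos : (0 : ℝ) < L := Nat.cast_pos.2 (Nat.pos_of_ne_zero (NeZero.ne L))
  have hL2 : (0 : ℝ) < (L : ℝ) ^ 2 := by positivity
  have hRpos : (0 : ℝ) < R := Nat.cast_pos.2 hR
  have hR2 : (0 : ℝ) < (R : ℝ) ^ 2 := by positivity
  have hR4 : (0 : ℝ) < (R : ℝ) ^ 4 := by positivity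
  have hRL' : R ≤ L := le_trans (Nat.le_mul_of_pos_left R two_pos) hRL
  set Sf : TorusSite 2 L → ℝ := pairStructureFactor dWaveFormFactor L ψ with hSf
  set F : TorusSite 2 L → ℝ := fun m => ‖∑ u : Fin 2 → Fin R, torusChar m (fun i => ((u i : ℕ) : ZMod L))‖
    with hF
  set W : Finset (TorusSite 2 L) :=
    Finset.univ.filter (fun m : TorusSite 2 L => m ≠ 0 ∧ momentumNormSq L m ≤ ε ^ 2) with hW
  have hSnn : ∀ m, 0 ≤ Sf m := fun m => pairStructureFactor_nonneg _ _ _ _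
  -- `R² T_R = Σ |F|² S`
  have hid := sq_mul_boxSum_eq_sum_boxKernel_mul_pairStructureFactor R hR hRL ψ
  rw [le_div_iff₀ hL2] at hseed
  have hmain : m₀ * (R : ℝ) ^ 2 * (L : ℝ) ^ 2 * (R : ℝ) ^ 2 ≤ ∑ m, F m ^ 2 * Sf m := by
    calc _ = (R : ℝ) ^ 2 * (m₀ * (R : ℝ) ^ 2 * (L : ℝ) ^ 2) := by ring
      _ ≤ _ := mul_le_mul_of_nonneg_left hseed hR2.le
      _ = ∑ m, F m ^ 2 * Sf m := hid
  -- kernel bound `|F|² ≤ R⁴`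
  have hFle : ∀ m, F m ^ 2 ≤ (R : ℝ) ^ 4 := fun m => by
    rw [show (R : ℝ) ^ 4 = ((R : ℝ) ^ 2) ^ 2 by ring]
    exact pow_le_pow_left₀ (norm_nonneg _) (norm_boxKernel_le (d := 2) m R) 2
  -- off the window the profile is flat: `S_ψ(m) ≤ S + A/ε`
  have hoff : ∀ m : TorusSite 2 L, m ≠ 0 → ε ^ 2 < momentumNormSq L m → Sf m ≤ S + A / ε := by
    intro m hm0 hq
    have hr : ε < Real.sqrt (momentumNormSq L m) := by
      rw [← Real.sqrt_sq hε.le]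
      exact Real.sqrt_lt_sqrt (sq_nonneg _) hq
    have h1 : A / Real.sqrt (momentumNormSq L m) ≤ A / ε :=
      div_le_div_of_nonneg_left hA hε hr.le
    exact (hprof m hm0).trans (by linarith)
  -- pointwise split of the summand
  have hpt : ∀ m ∈ (Finset.univ : Finset (TorusSite 2 L)), F m ^ 2 * Sf m ≤
      (if m = 0 then (R : ℝ) ^ 4 * Sf m else 0) + (if m ∈ W then (R : ℝ) ^ 4 * Sf m else 0) +
        (S + A / ε) * F m ^ 2 := by
    intro m _
    have hc3 : 0 ≤ (S + A / ε) * F m ^ 2 := mul_nonneg (by positivity) (sq_nonneg _)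
    have hb : F m ^ 2 * Sf m ≤ (R : ℝ) ^ 4 * Sf m := mul_le_mul_of_nonneg_right (hFle m) (hSnn m)
    by_cases hm0 : m = 0
    · rw [if_pos hm0]
      have hW0 : 0 ≤ (if m ∈ W then (R : ℝ) ^ 4 * Sf m else 0) := by
        split_ifs
        · exact mul_nonneg hR4.le (hSnn m)
        · exact le_rfl
      linarith
    · rw [if_neg hm0, zero_add]
      by_cases hmW : m ∈ W
      · rw [if_pos hmW]
        linarith
      · rw [if_neg hmW, zero_add]
        have hq : ε ^ 2 < momentumNormSq L m := by
          rw [hW, Finset.mem_filter] at hmW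
          push Not at hmW
          exact hmW (Finset.mem_univ m) hm0
        exact mul_comm (Sf m) (F m ^ 2) ▸ mul_le_mul_of_nonneg_right (hoff m hm0 hq) (sq_nonneg _)
  have hsplit : ∑ m, F m ^ 2 * Sf m ≤
      (R : ℝ) ^ 4 * Sf 0 + (R : ℝ) ^ 4 * ∑ m ∈ W, Sf m + (S + A / ε) * ∑ m, F m ^ 2 := by
    refine (Finset.sum_le_sum hpt).trans (le_of_eq ?_)
    rw [Finset.sum_add_distrib, Finset.sum_add_distrib, Finset.sum_ite_eq' Finset.univ (0 : TorusSite 2 L),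
      if_pos (Finset.mem_univ _), Fintype.sum_ite_mem, ← Finset.mul_sum, ← Finset.mul_sum]
  -- the three bounds
  have hwin : ∑ m ∈ W, Sf m ≤ 32 * ε * (S * ε + A) * (L : ℝ) ^ 2 :=
    windowProfileSum_le L hε hS hA Sf hprof
  have hpars : ∑ m, F m ^ 2 = (L : ℝ) ^ 2 * (R : ℝ) ^ 2 := sum_normSq_boxKernel_eq R hRL'
  have hSAε : 0 ≤ S + A / ε := by positivity
  -- assemble
  have key : m₀ * (R : ℝ) ^ 2 * (L : ℝ) ^ 2 * (R : ℝ) ^ 2 ≤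
      (R : ℝ) ^ 4 * Sf 0 + (R : ℝ) ^ 4 * (32 * ε * (S * ε + A) * (L : ℝ) ^ 2) +
        (S + A / ε) * ((L : ℝ) ^ 2 * (R : ℝ) ^ 2) := by
    refine hmain.trans (hsplit.trans ?_)
    rw [hpars]
    have := mul_le_mul_of_nonneg_left hwin hR4.le
    linarith
  have key' : (R : ℝ) ^ 4 * ((m₀ - 32 * ε * (S * ε + A) - (S + A / ε) / (R : ℝ) ^ 2) * (L : ℝ) ^ 2) ≤
      (R : ℝ) ^ 4 * Sf 0 := by
    have e : (R : ℝ) ^ 4 * ((m₀ - 32 * ε * (S * ε + A) - (S + A / ε) / (R : ℝ) ^ 2) * (L : ℝ) ^ 2) =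
        m₀ * (R : ℝ) ^ 2 * (L : ℝ) ^ 2 * (R : ℝ) ^ 2 - (R : ℝ) ^ 4 * (32 * ε * (S * ε + A) * (L : ℝ) ^ 2) -
          (S + A / ε) * ((L : ℝ) ^ 2 * (R : ℝ) ^ 2) := by
      field_simp
    rw [e]
    linarith
  exact le_of_mul_le_mul_left key' hR4

/-- The zero mode of the pair structure factor is the LRO quantity of the summit:
`S_ψ(0) = Re⟨ψ, Δ_dᴴ Δ_d ψ⟩ / L²`, `Δ_d = pairField dWaveFormFactor L`. [folklore] -/
theorem pairStructureFactor_zero_eq_re_dotProduct (ψ : Fock (Orb (FermionTorus 2 L))) :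
    pairStructureFactor dWaveFormFactor L ψ 0 =
      (star ψ ⬝ᵥ Matrix.mulVec (Matrix.conjTranspose (pairField dWaveFormFactor L) *
        pairField dWaveFormFactor L) ψ).re / (L : ℝ) ^ 2 := by
  rw [pairStructureFactor_zero]
  rfl

/-! ### The split: (A) Goldstone pair profile → (B) leak-beating block pair seed → the crux -/

/-- **GLUE (sorry-free)**: `(A) → (B) → MesoscopicPairOrder`, hypotheses = the verbatim statements of
`stub_goldstonePairProfile` and `stub_leakBeatingBlockPairSeed` (so that, once landed under `Theorems/`, the
same term is the `--glue-by` theorem of the route split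
`MesoscopicPairOrder ⇐ GoldstonePairProfile ∧ LeakBeatingBlockPairSeed`).

(A) `GoldstonePairProfile`: at every `U > 0`, `δ ∈ (0, 1/2)` there are `S, A ≥ 0` and `L₀` such that
every normalised `(N_L, 0)`-sector ground state `ψ` of `hubbardTorus 2 L 1 U`, `L ≥ L₀` even, has
`S_ψ(m) ≤ S + A/|q_m|` for every momentum label `m ≠ 0`.
(B) `LeakBeatingBlockPairSeed`: at some `U > 0`, `δ ∈ (0, 1/2)`, for all `S, A ≥ 0` there are a scale
`R₀ > 0`, a radius `ε > 0` and a margin `m₀` with `32ε(Sε + A) + (S + A/ε)/R₀² < m₀` such that the crux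
body holds at the single scale `R₀` with margin `m₀` (all large even `L`, every normalised sector
ground state).
Proof: at (B)'s `(U, δ)` take (A)'s `(S, A)`, then (B)'s `(R₀, ε, m₀)`; the pointwise one-scale
closure gives uniform sector pair order `a = m₀ - 32ε(Sε + A) - (S + A/ε)/R₀² > 0`, i.e.
`a ≤ Re⟨ψ, Δ_dᴴΔ_d ψ⟩/L⁴` for every normalised sector ground state of every even `L ≥ max L₀ L₁ (2R₀)`,
and `mesoscopicPairOrder_of_uniformPairOrder` concludes. Kennedy–Lieb–Shastry, PRL 61 (1988) 2582;
Dyson–Lieb–Simon (1978) Thms 3.1–4.2. [folklore] -/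
theorem mesoscopicPairOrder_of_subs :
    (∀ U : ℝ, 0 < U → ∀ δ ∈ Set.Ioo (0:ℝ) (1 / 2), ∃ S A : ℝ, 0 ≤ S ∧ 0 ≤ A ∧ ∃ L₀ : ℕ,
      ∀ (L : ℕ) [NeZero L], L₀ ≤ L → Even L →
        ∀ ψ : Fock (Orb (FermionTorus 2 L)), star ψ ⬝ᵥ ψ = 1 →
          IsGroundStateInSector (hubbardTorus 2 L 1 U) (2 * ⌊(1 - δ) * (L : ℝ) ^ 2 / 2⌋₊) 0 ψ →
            ∀ m : TorusSite 2 L, m ≠ 0 →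
              pairStructureFactor dWaveFormFactor L ψ m ≤ S + A / Real.sqrt (momentumNormSq L m)) →
    (∃ U : ℝ, 0 < U ∧ ∃ δ ∈ Set.Ioo (0:ℝ) (1 / 2), ∀ S A : ℝ, 0 ≤ S → 0 ≤ A →
      ∃ (R₀ : ℕ) (ε m₀ : ℝ), 0 < R₀ ∧ 0 < ε ∧
        32 * ε * (S * ε + A) + (S + A / ε) / (R₀ : ℝ) ^ 2 < m₀ ∧
        ∃ L₀ : ℕ, ∀ (L : ℕ) [NeZero L], L₀ ≤ L → Even L →
          ∀ ψ : Fock (Orb (FermionTorus 2 L)), star ψ ⬝ᵥ ψ = 1 →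
            IsGroundStateInSector (hubbardTorus 2 L 1 U) (2 * ⌊(1 - δ) * (L : ℝ) ^ 2 / 2⌋₊) 0 ψ →
              m₀ * (R₀ : ℝ) ^ 2 ≤ (∑ x : Fin 2 → ZMod L, ∑ y : Fin 2 → ZMod L,
                (∏ i : Fin 2, max 0 (1 - |(((y i - x i).valMinAbs : ℤ) : ℝ)| / (R₀ : ℝ))) *
                  (star (Matrix.mulVec (localPair dWaveFormFactor L x) ψ) ⬝ᵥ
                    Matrix.mulVec (localPair dWaveFormFactor L y) ψ).re) / (L : ℝ) ^ 2) →
    MesoscopicPairOrder := by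
  intro hA hB
  obtain ⟨U, hU, δ, hδ, hBall⟩ := hB
  obtain ⟨S, A, hS, hA0, L₀, hprof⟩ := hA U hU δ hδ
  obtain ⟨R₀, ε, m₀, hR₀, hε, hleak, L₁, hseed⟩ := hBall S A hS hA0
  set a : ℝ := m₀ - 32 * ε * (S * ε + A) - (S + A / ε) / (R₀ : ℝ) ^ 2 with ha_def
  have ha : 0 < a := by rw [ha_def]; linarith
  refine mesoscopicPairOrder_of_uniformPairOrder ⟨U, hU, δ, hδ, a, ha, max (max L₀ L₁) (2 * R₀), ?_⟩
  intro L _ hL hE ψ hψ hgs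
  have hL₀ : L₀ ≤ L := le_trans (le_max_left _ _) (le_of_max_le_left hL)
  have hL₁ : L₁ ≤ L := le_trans (le_max_right _ _) (le_of_max_le_left hL)
  have h2R : 2 * R₀ ≤ L := le_of_max_le_right hL
  have hLpos : (0 : ℝ) < L := Nat.cast_pos.2 (Nat.pos_of_ne_zero (NeZero.ne L))
  have hL2 : (0 : ℝ) < (L : ℝ) ^ 2 := by positivity
  have hprof' := hprof L hL₀ hE ψ hψ hgs
  have hseed' := hseed L hL₁ hE ψ hψ hgs
  have hcore := pairStructureFactor_zero_ge_of_seed_of_profile R₀ hR₀ h2R hε hS hA0 ψ hprof' hseed'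
  rw [pairStructureFactor_zero_eq_re_dotProduct, le_div_iff₀ hL2] at hcore
  rw [le_div_iff₀ (by positivity : (0 : ℝ) < (L : ℝ) ^ 4)]
  calc a * (L : ℝ) ^ 4 = a * (L : ℝ) ^ 2 * (L : ℝ) ^ 2 := by ring
    _ ≤ _ := hcore

/-- **(A) subsumes the route's pole half**: `GoldstonePairProfile → WindowInfraredBound` (with
`ε₀ = 1`, `C = 32 (S + A)`): on the window `|q_m| ≤ 1` the profile gives the Goldstone shape
`S_ψ(m) · |q_m| ≤ S + A`, and `wib_of_goldstoneShape` sums it. So after the split the Σ-form crux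
stmt-1089 is implied by sub-crux (A); a refutation of stmt-1089 refutes (A). [folklore] -/
theorem windowInfraredBound_of_goldstonePairProfile
    (hA : ∀ U : ℝ, 0 < U → ∀ δ ∈ Set.Ioo (0:ℝ) (1 / 2), ∃ S A : ℝ, 0 ≤ S ∧ 0 ≤ A ∧ ∃ L₀ : ℕ,
      ∀ (L : ℕ) [NeZero L], L₀ ≤ L → Even L →
        ∀ ψ : Fock (Orb (FermionTorus 2 L)), star ψ ⬝ᵥ ψ = 1 →
          IsGroundStateInSector (hubbardTorus 2 L 1 U) (2 * ⌊(1 - δ) * (L : ℝ) ^ 2 / 2⌋₊) 0 ψ →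
            ∀ m : TorusSite 2 L, m ≠ 0 →
              pairStructureFactor dWaveFormFactor L ψ m ≤ S + A / Real.sqrt (momentumNormSq L m)) :
    WindowInfraredBound := by
  refine wib_of_goldstoneShape fun U hU δ hδ => ?_
  obtain ⟨S, A, hS, hA0, L₀, hprof⟩ := hA U hU δ hδ
  refine ⟨S + A, 1, by positivity, one_pos, L₀, fun L _ hL hE ψ hψ hgs m hm0 hm1 => ?_⟩
  have hqpos : 0 < momentumNormSq L m :=
    lt_of_le_of_ne (momentumNormSq_nonneg m) (fun h => hm0 ((momentumNormSq_eq_zero_iff m).1 h.symm))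
  have hr : 0 < Real.sqrt (momentumNormSq L m) := Real.sqrt_pos.2 hqpos
  have hr1 : Real.sqrt (momentumNormSq L m) ≤ 1 := by
    rw [← Real.sqrt_one]
    exact Real.sqrt_le_sqrt (by simpa using hm1)
  have h := hprof L hL hE ψ hψ hgs m hm0
  have hSnn : 0 ≤ pairStructureFactor dWaveFormFactor L ψ m := pairStructureFactor_nonneg _ _ _ _
  -- `S_ψ · r ≤ (S + A/r) · r = S r + A ≤ S + A`
  calc pairStructureFactor dWaveFormFactor L ψ m * Real.sqrt (momentumNormSq L m)
      ≤ (S + A / Real.sqrt (momentumNormSq L m)) * Real.sqrt (momentumNormSq L m) :=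
        mul_le_mul_of_nonneg_right h hr.le
    _ = S * Real.sqrt (momentumNormSq L m) + A := by field_simp
    _ ≤ S * 1 + A := by nlinarith
    _ = S + A := by ring

/-- **(B) is a consequence of the crux**: `MesoscopicPairOrder → LeakBeatingBlockPairSeed`. Given the
crux's margin `m` at arbitrarily large scales and a budget `(S, A)`: take `m₀ := m`, the radius
`ε := min 1 (m / (64 (S + A + 1)))` (so `32ε(Sε + A) < m/2`), a threshold `R₁ > 2(S + A/ε)/m`, and
the crux's scale `R ≥ max R₁ 1` (so `(S + A/ε)/R² ≤ (S + A/ε)/R < m/2`). Hence sub-crux (B) is NOT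
stronger than the crux; it is the crux's single-scale shadow. [folklore] -/
theorem leakBeatingBlockPairSeed_of_mesoscopicPairOrder (h : MesoscopicPairOrder) :
    ∃ U : ℝ, 0 < U ∧ ∃ δ ∈ Set.Ioo (0:ℝ) (1 / 2), ∀ S A : ℝ, 0 ≤ S → 0 ≤ A →
      ∃ (R₀ : ℕ) (ε m₀ : ℝ), 0 < R₀ ∧ 0 < ε ∧
        32 * ε * (S * ε + A) + (S + A / ε) / (R₀ : ℝ) ^ 2 < m₀ ∧
        ∃ L₀ : ℕ, ∀ (L : ℕ) [NeZero L], L₀ ≤ L → Even L →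
          ∀ ψ : Fock (Orb (FermionTorus 2 L)), star ψ ⬝ᵥ ψ = 1 →
            IsGroundStateInSector (hubbardTorus 2 L 1 U) (2 * ⌊(1 - δ) * (L : ℝ) ^ 2 / 2⌋₊) 0 ψ →
              m₀ * (R₀ : ℝ) ^ 2 ≤ (∑ x : Fin 2 → ZMod L, ∑ y : Fin 2 → ZMod L,
                (∏ i : Fin 2, max 0 (1 - |(((y i - x i).valMinAbs : ℤ) : ℝ)| / (R₀ : ℝ))) *
                  (star (Matrix.mulVec (localPair dWaveFormFactor L x) ψ) ⬝ᵥ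
                    Matrix.mulVec (localPair dWaveFormFactor L y) ψ).re) / (L : ℝ) ^ 2 := by
  obtain ⟨U, hU, δ, hδ, m, hm, hall⟩ := h
  refine ⟨U, hU, δ, hδ, fun S A hS hA => ?_⟩
  -- the radius
  set ε : ℝ := min 1 (m / (64 * (S + A + 1))) with hε_def
  have hSA1 : 0 < S + A + 1 := by linarith
  have hεpos : 0 < ε := lt_min one_pos (by positivity)
  have hε1 : ε ≤ 1 := min_le_left _ _
  have hε2 : ε ≤ m / (64 * (S + A + 1)) := min_le_right _ _
  have hwin : 32 * ε * (S * ε + A) < m / 2 := by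
    have h1 : S * ε + A ≤ S + A := by nlinarith
    have h2 : 32 * ε * (S * ε + A) ≤ 32 * ε * (S + A) := by nlinarith
    have h3 : 32 * ε * (S + A) ≤ 32 * (m / (64 * (S + A + 1))) * (S + A) := by nlinarith
    have h4 : 32 * (m / (64 * (S + A + 1))) * (S + A) < m / 2 := by
      have hlt : (S + A) / (S + A + 1) < 1 := by rw [div_lt_one hSA1]; linarith
      have heq : 32 * (m / (64 * (S + A + 1))) * (S + A) = (m / 2) * ((S + A) / (S + A + 1)) := by
        field_simp
        ring
      rw [heq]
      have : (m / 2) * ((S + A) / (S + A + 1)) < (m / 2) * 1 := mul_lt_mul_of_pos_left hlt (by positivity)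
      linarith
    linarith
  -- the budget off the window and the scale
  set K : ℝ := S + A / ε with hK_def
  have hK : 0 ≤ K := by positivity
  obtain ⟨R, hR₁, L₀, hL⟩ := hall (max (⌈2 * K / m⌉₊ + 1) 1)
  have hR1 : 1 ≤ R := le_trans (le_max_right _ _) hR₁
  have hRpos : 0 < R := hR1
  have hRreal : (1 : ℝ) ≤ R := by exact_mod_cast hR1
  have hRgt : 2 * K / m < (R : ℝ) := by
    have h1 : 2 * K / m ≤ (⌈2 * K / m⌉₊ : ℝ) := Nat.le_ceil _
    have h2 : ((⌈2 * K / m⌉₊ + 1 : ℕ) : ℝ) ≤ (R : ℝ) := by exact_mod_cast le_trans (le_max_left _ _) hR₁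
    push_cast at h2
    linarith
  have htail : K / (R : ℝ) ^ 2 < m / 2 := by
    have hKR : K / (R : ℝ) ^ 2 ≤ K / (R : ℝ) := by
      apply div_le_div_of_nonneg_left hK (by positivity)
      nlinarith
    have hKR' : K / (R : ℝ) < m / 2 := by
      rw [div_lt_iff₀ (by positivity)]
      rw [div_lt_iff₀ hm] at hRgt
      linarith
    exact lt_of_le_of_lt hKR hKR'
  refine ⟨R, ε, m, hRpos, hεpos, by rw [hK_def] at htail; linarith, L₀, ?_⟩
  intro L _ hLL hE ψ hψ hgs
  exact hL L hLL hE ψ hψ hgs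

/-- **Registered form of the glue** (`mesoscopicPairOrderOfSubs`, stub of stmt-7331): the one-line
verbatim signature `(A) → (B) → MesoscopicPairOrder`, by `mesoscopicPairOrder_of_subs`. [folklore] -/
theorem mesoscopicPairOrderOfSubs : (∀ U : ℝ, 0 < U → ∀ δ ∈ Set.Ioo (0:ℝ) (1 / 2), ∃ S A : ℝ, 0 ≤ S ∧ 0 ≤ A ∧ ∃ L₀ : ℕ, ∀ (L : ℕ) [NeZero L], L₀ ≤ L → Even L → ∀ ψ : Fock (Orb (FermionTorus 2 L)), star ψ ⬝ᵥ ψ = 1 → IsGroundStateInSector (hubbardTorus 2 L 1 U) (2 * ⌊(1 - δ) * (L : ℝ) ^ 2 / 2⌋₊) 0 ψ → ∀ m : TorusSite 2 L, m ≠ 0 → pairStructureFactor dWaveFormFactor L ψ m ≤ S + A / Real.sqrt (momentumNormSq L m)) → (∃ U : ℝ, 0 < U ∧ ∃ δ ∈ Set.Ioo (0:ℝ) (1 / 2), ∀ S A : ℝ, 0 ≤ S → 0 ≤ A → ∃ (R₀ : ℕ) (ε m₀ : ℝ), 0 < R₀ ∧ 0 < ε ∧ 32 * ε * (S * ε + A)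 + (S + A / ε) / (R₀ : ℝ) ^ 2 < m₀ ∧ ∃ L₀ : ℕ, ∀ (L : ℕ) [NeZero L], L₀ ≤ L → Even L → ∀ ψ : Fock (Orb (FermionTorus 2 L)), star ψ ⬝ᵥ ψ = 1 → IsGroundStateInSector (hubbardTorus 2 L 1 U) (2 * ⌊(1 - δ) * (L : ℝ) ^ 2 / 2⌋₊) 0 ψ → m₀ * (R₀ : ℝ) ^ 2 ≤ (∑ x : Fin 2 → ZMod L, ∑ y : Fin 2 → ZMod L, (∏ i : Fin 2, max 0 (1 - |(((y i - x i).valMinAbs : ℤ) : ℝ)| / (R₀ : ℝ))) * (star (Matrix.mulVec (localPair dWaveFormFactor L x) ψ) ⬝ᵥ Matrix.mulVec (localPair dWaveFormFactor L y) ψ).re) / (L : ℝ) ^ 2) → Summit.HubbardSuperconductivity.HubbardSuperconductivity.Theses.FunctionFieldCertificate.MesoscopicPairOrder :=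
  mesoscopicPairOrder_of_subs

end Summit.HubbardSuperconductivity.HubbardSuperconductivity.Theorems.FunctionFieldCertificate
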